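import Mathlib
import HarnessLib
import Summits.QuantumFields.YangMills.Theorems.MirrorModularBoostsHypercubicLimitPlaneLimitsDefs
import Literature.MathematicalPhysics.AQFT.OSAxiomsSchwinger

/-!
# Line `Sketch` (coupling response): E0′ (linear growth) of the summed plane-string limits

Sub-goal `planeSum_hasLinearGrowth` of crux `stmt-QuantumFields-16154` (`HypercubicLimit`), line `Sketch`, step Z3a.
From `planeSum_bound` the candidate one-field family obeys `‖planeSum T n F‖ ≤ α 6ⁿ (n!)^β |F|_{n s}`; absorbing
`6ⁿ ≤ e⁶ · n!` into the factorial power gives the labelled E0′ bound with constants `|α| e⁶` and `β + 1`.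
-/

noncomputable section

open scoped SchwartzMap BigOperators
open MeasureTheory Filter Topology
open Literature.MathematicalPhysics.AQFT Literature.MathematicalPhysics.QuantumLattice
open Literature.MathematicalPhysics.QuantumFieldTheory

namespace Summit.QuantumFields.YangMills.Cruxes.HypercubicLimit.CouplingResponse

/-- **Registered sub-goal `planeSum_hasLinearGrowth` (line `Sketch`, step Z3a)**: the candidate one-field Schwinger
family `planeSum T` of a `PlaneLimits` package satisfies OS's linear growth condition E0′: the `6ⁿ` plane strings
are absorbed into the factorial power via `6ⁿ ≤ e⁶ n!`, so `σₙ ≤ |α| e⁶ (n!)^{β+1}`. [folklore] -/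
theorem planeSum_hasLinearGrowth : ∀ (G : Type) [Group G] [TopologicalSpace G] [IsTopologicalGroup G] [CompactSpace G] [MeasurableSpace G] [BorelSpace G] (r : LatticeRep G) (sch : SpeciesScheme (YMSpecies G)) (φ : ℕ → ℕ) (T : (n : ℕ) → (Fin n → Plane) → (𝓢((Fin n → EuclideanSpace ℝ (Fin 4)), ℂ) →L[ℂ] ℂ)), PlaneLimits r sch φ T → (planeSum T).toLabelled.HasLinearGrowth := by
  intro G _ _ _ _ _ _ r sch φ T h
  obtain ⟨s, α, β, hb⟩ := planeSum_bound G r sch φ T h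
  intro _
  refine ⟨s, |α| * Real.exp 6, β + 1, fun n k _ F _ => ?_⟩
  rw [SchwingerFamily.toLabelled_apply]
  have hfac : (0 : ℝ) < (n.factorial : ℝ) := by exact_mod_cast n.factorial_pos
  have hN : 0 ≤ schwartzNorm (n * s) F := schwartzNorm_nonneg _ _
  have hβ : 0 ≤ (n.factorial : ℝ) ^ β := Real.rpow_nonneg hfac.le β
  have h6 : (6 : ℝ) ^ n ≤ Real.exp 6 * (n.factorial : ℝ) := by
    have h := Real.pow_div_factorial_le_exp (x := 6) (by norm_num) n
    rwa [div_le_iff₀ hfac] at h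
  calc ‖planeSum T n F‖ ≤ α * (6 : ℝ) ^ n * (n.factorial : ℝ) ^ β * schwartzNorm (n * s) F := hb n F
    _ ≤ |α| * (6 : ℝ) ^ n * (n.factorial : ℝ) ^ β * schwartzNorm (n * s) F := by
        gcongr
        exact le_abs_self α
    _ ≤ |α| * (Real.exp 6 * (n.factorial : ℝ)) * (n.factorial : ℝ) ^ β * schwartzNorm (n * s) F := by
        gcongr
    _ = |α| * Real.exp 6 * (n.factorial : ℝ) ^ (β + 1) * schwartzNorm (n * s) F := by
        rw [Real.rpow_add_one hfac.ne']
        ring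

end Summit.QuantumFields.YangMills.Cruxes.HypercubicLimit.CouplingResponse

end
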